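import Mathlib
import Summits.NavierStokesRegularity.NavierStokesRegularity.Theorems.TaoLadderRungTwoBreakOneShiftWindowFlatWindow
import Summits.NavierStokesRegularity.NavierStokesRegularity.Theorems.TaoLadderRungTwoBreakOneShiftWindowRunSlope
import HarnessLib

/-!
# The one-shift window system, XX: the STEP GRID — restriction of a run to a step, composition of per-step pair
# slopes over a finite grid plus the final (smeared) step, and the adapter delivering the flow-slope hypothesis
# `hU` of part XIII from flat data (cell harvest/h2-tao-ladder, seat p2; rung1/KERNEL-CHEAP-REPLAY-SPEC.md §7
# (R3)/(R4); support for K1(1) = `NoSurvivingDSSOne`, stmt-NavierStokesRegularity-20205)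

MODEL lattice ODEs only (Tao 2016 §4 normal form on Tao's shift set `S`); nothing here is a statement about
the Navier–Stokes equations; no item is closed; nothing numerical is proved.

* `hasDerivWithinAt_shift` — a solution on `[0, T]` restricted to `[t₀, t₀ + h]` and re-clocked to `[0, h]` is a
  solution of the re-clocked field (the form parts XVI/XVII take);
* `exists_chainSlope_fin` — per-step pair slopes on a FINITE grid compose to the ordered product (part XIII
  `exists_chainSlope` with the hypothesis only for `s < S`);
* `exists_gridSlope` — grid steps + the final step from `t S` to the flight time, + an enclosure of all the products
  (the replay's `V` recursion) ⇒ ONE real matrix `U ∈ [Ulo, Uhi]` with `S_u(τ) − S_v(τ) = U · (S_u(0) − S_v(0))`;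
* `flowSlope_of_flat` — the adapter: such a flat `U` for the window runs of two admissible points, read at the
  flight time of `u`, IS the hypothesis `hU` of part XIII `exists_runSlope` (columns re-indexed to `(i, widx k)`).
-/

noncomputable section

-- the sub-problem namespace repeats the summit name by design (D-0017)
set_option linter.dupNamespace false

namespace Summit.NavierStokesRegularity.NavierStokesRegularity.Theorems

namespace DSSOneShift

open Set Metric

/-! ### Re-clocking a run to a step -/

/-- **Re-clocking a solution to a step.** If `S` has derivative `S' t` within `[0, T]` at every `t ∈ [0, T]` and
`0 ≤ t₀`, `t₀ + h ≤ T`, then `r ↦ S (t₀ + r)` has derivative `S' (t₀ + r)` within `[0, h]` at every `r ∈ [0, h]`.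
[folklore] -/
theorem hasDerivWithinAt_shift {E : Type*} [NormedAddCommGroup E] [NormedSpace ℝ E] {S S' : ℝ → E} {T t₀ h : ℝ}
    (hS : ∀ t ∈ Icc 0 T, HasDerivWithinAt S (S' t) (Icc 0 T) t) (ht₀ : 0 ≤ t₀) (hT : t₀ + h ≤ T)
    {r : ℝ} (hr : r ∈ Icc 0 h) : HasDerivWithinAt (fun r => S (t₀ + r)) (S' (t₀ + r)) (Icc 0 h) r := by
  have hmem : t₀ + r ∈ Icc 0 T := ⟨by linarith [hr.1], by linarith [hr.2]⟩
  have hmaps : MapsTo (fun r : ℝ => t₀ + r) (Icc 0 h) (Icc 0 T) := fun r' hr' =>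
    ⟨by linarith [hr'.1], by linarith [hr'.2]⟩
  have hid : HasDerivWithinAt (fun r : ℝ => t₀ + r) 1 (Icc 0 h) r := by
    simpa using ((hasDerivWithinAt_id r (Icc 0 h)).const_add t₀)
  have h := (hS (t₀ + r) hmem).scomp r hid hmaps
  rw [one_smul] at h
  exact h

/-! ### Finite chains of pair slopes -/

variable {ι : Type*} [Fintype ι] [DecidableEq ι]

/-- **Per-step pair slopes on a finite grid compose.** If `d (s+1) = U_s · d s` with `U_s ∈ [lo s, hi s]` for every
`s < S`, then `d S = (U_{S-1} ⋯ U_0) · d 0` for such a family. [cite: Tao2016AveragedNS, §5.3; cell vocabulary, harvest/h2-tao-ladder rung1/KERNEL-CHEAP-REPLAY-SPEC.md §2 (g)] -/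
theorem exists_chainSlope_fin (d : ℕ → ι → ℝ) (lo hi : ℕ → Matrix ι ι ℝ) (S : ℕ)
    (hstep : ∀ s < S, ∃ U : Matrix ι ι ℝ, (∀ i j, lo s i j ≤ U i j ∧ U i j ≤ hi s i j) ∧
      d (s + 1) = U.mulVec (d s)) :
    ∃ U : ℕ → Matrix ι ι ℝ, (∀ s < S, ∀ i j, lo s i j ≤ U s i j ∧ U s i j ≤ hi s i j) ∧
      d S = ((List.range S).map U).reverse.prod.mulVec (d 0) := by
  classical
  -- choose the step matrices where they exist, junk elsewhere
  have hchoice : ∀ s, ∃ U : Matrix ι ι ℝ, s < S → (∀ i j, lo s i j ≤ U i j ∧ U i j ≤ hi s i j) ∧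
      d (s + 1) = U.mulVec (d s) := by
    intro s
    by_cases hs : s < S
    · obtain ⟨U, hU, hd⟩ := hstep s hs; exact ⟨U, fun _ => ⟨hU, hd⟩⟩
    · exact ⟨1, fun h => absurd h hs⟩
  choose U hU using hchoice
  refine ⟨U, fun s hs => (hU s hs).1, ?_⟩
  have key : ∀ n ≤ S, d n = ((List.range n).map U).reverse.prod.mulVec (d 0) := by
    intro n hn
    induction n with
    | zero => simp
    | succ n ih =>
      rw [(hU n (by omega)).2, ih (by omega), Matrix.mulVec_mulVec, List.range_succ, List.map_append,
        List.reverse_append, List.prod_append]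
      simp
  exact key S le_rfl

/-- **Grid steps + final step + product enclosure ⇒ one flow slope.** Two trajectories `Su`, `Sv` sampled on a
grid `t 0 = 0, t 1, …, t S` with per-step pair slopes in `[lo s, hi s]`, a final pair slope in `[loB, hiB]` from
`t S` to the time `τ`, and an entrywise enclosure `[Ulo, Uhi]` of `U_B · U_{S-1} ⋯ U_0` for ALL such matrices (the
replay's interval product) give a real `U ∈ [Ulo, Uhi]` with `Su τ − Sv τ = U · (Su 0 − Sv 0)`.
[cite: Tao2016AveragedNS, §5.3; cell vocabulary, harvest/h2-tao-ladder rung1/KERNEL-CHEAP-REPLAY-SPEC.md §2 (g)/(h), §7 (R4)] -/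
theorem exists_gridSlope (Su Sv : ℝ → ι → ℝ) (t : ℕ → ℝ) (ht0 : t 0 = 0) (S : ℕ) (τ : ℝ)
    (lo hi : ℕ → Matrix ι ι ℝ) (loB hiB Ulo Uhi : Matrix ι ι ℝ)
    (hstep : ∀ s < S, ∃ U : Matrix ι ι ℝ, (∀ i j, lo s i j ≤ U i j ∧ U i j ≤ hi s i j) ∧
      Su (t (s + 1)) - Sv (t (s + 1)) = U.mulVec (Su (t s) - Sv (t s)))
    (hfinal : ∃ U : Matrix ι ι ℝ, (∀ i j, loB i j ≤ U i j ∧ U i j ≤ hiB i j) ∧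
      Su τ - Sv τ = U.mulVec (Su (t S) - Sv (t S)))
    (hprod : ∀ (Us : ℕ → Matrix ι ι ℝ) (UB : Matrix ι ι ℝ),
      (∀ s < S, ∀ i j, lo s i j ≤ Us s i j ∧ Us s i j ≤ hi s i j) → (∀ i j, loB i j ≤ UB i j ∧ UB i j ≤ hiB i j) →
      ∀ i j, Ulo i j ≤ (UB * ((List.range S).map Us).reverse.prod) i j ∧
        (UB * ((List.range S).map Us).reverse.prod) i j ≤ Uhi i j) :
    ∃ U : Matrix ι ι ℝ, (∀ i j, Ulo i j ≤ U i j ∧ U i j ≤ Uhi i j) ∧ Su τ - Sv τ = U.mulVec (Su 0 - Sv 0) := by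
  obtain ⟨Us, hUs, hchain⟩ := exists_chainSlope_fin (fun s => Su (t s) - Sv (t s)) lo hi S hstep
  obtain ⟨UB, hUB, hB⟩ := hfinal
  refine ⟨UB * ((List.range S).map Us).reverse.prod, hprod Us UB hUs hUB, ?_⟩
  rw [hB, hchain, Matrix.mulVec_mulVec, ht0]

/-! ### The adapter to part XIII -/

variable {m : ℕ}

namespace OneShiftFrame

variable (F : OneShiftFrame m)

/-- Re-indexing a flat slope matrix to the `(mode, ℤ-shell)` rows of part XIII (zero off the window). [folklore] -/
def slopeOfFlat (U : Matrix F.SIdx F.SIdx ℝ) : Fin m → ℤ → F.SIdx → ℝ :=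
  fun i k c => if h : F.InWindow k then U (i, F.widx h) c else 0

/-- At time `0` the flat run of a run from `(y, T)` is the flat window start. [folklore] -/
theorem flatRun_zero {ε₀ : ℝ} {α : Fin m → Fin m → Fin m → ℤ × ℤ × ℤ → ℝ} {y : Fin m → ℤ → ℝ}
    {T S : Fin m → ℤ → ℝ → ℝ} (hS : F.IsRunFrom ε₀ α y T S) (c : F.SIdx) :
    F.flatRun S 0 c = y c.1 ((c.2 : ℕ) : ℤ) :=
  hS.2.1 c.1 _ (F.inWindow_natCast c.2)

/-- **The adapter.** If the flat window runs `S_u`, `S_v` of two points (runs from their pre-clamped data) satisfy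
`flatRun S_u τ − flatRun S_v τ = U · (flatRun S_u 0 − flatRun S_v 0)`, then the hypothesis `hU` of part XIII
`exists_runSlope` holds at the time `τ` with the re-indexed matrix `slopeOfFlat U`.
[cite: Tao2016AveragedNS, §5.3; cell vocabulary, harvest/h2-tao-ladder rung1/KERNEL-CHEAP-REPLAY-SPEC.md §7 (R4)] -/
theorem flowSlope_of_flat {ε₀ : ℝ} {α : Fin m → Fin m → Fin m → ℤ × ℤ × ℤ → ℝ} {u v : F.Space}
    {Su Sv : Fin m → ℤ → ℝ → ℝ}
    (hSu : F.IsRunFrom ε₀ α (F.preclampY u) (F.preclampTail u) Su)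
    (hSv : F.IsRunFrom ε₀ α (F.preclampY v) (F.preclampTail v) Sv)
    {U : Matrix F.SIdx F.SIdx ℝ} {τ : ℝ}
    (hU : F.flatRun Su τ - F.flatRun Sv τ = U.mulVec (F.flatRun Su 0 - F.flatRun Sv 0)) :
    ∀ i k, F.InWindow k → Su i k τ - Sv i k τ =
      ∑ c : F.SIdx, F.slopeOfFlat U i k c * (F.preclampY u c.1 ((c.2 : ℕ) : ℤ) - F.preclampY v c.1 ((c.2 : ℕ) : ℤ)) := by
  intro i k hk
  have h := congrFun hU (i, F.widx hk)
  simp only [Pi.sub_apply, Matrix.mulVec, dotProduct] at h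
  have e : Su i k τ - Sv i k τ = F.flatRun Su τ (i, F.widx hk) - F.flatRun Sv τ (i, F.widx hk) := by
    simp only [flatRun, F.natCast_widx hk]
  rw [e, h]
  refine Finset.sum_congr rfl fun c _ => ?_
  rw [slopeOfFlat, dif_pos hk, F.flatRun_zero hSu, F.flatRun_zero hSv]

end OneShiftFrame

end DSSOneShift

end Summit.NavierStokesRegularity.NavierStokesRegularity.Theorems
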